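import Summits.ResolutionOfSingularities.ResolutionOfSingularities.Theorems.HilbertSamuelEliminationSigmaMaxModificationsCorridor3SigmaCyclePlusDefs
import Summits.ResolutionOfSingularities.ResolutionOfSingularities.Theorems.HilbertSamuelEliminationSigmaMaxModificationsCorridor3SigmaBoundaryRuns
import HarnessLib

/-!
# [OURS · L1 W4.2] σ-LAYER — Ω⁺E: the END-rule variant over BOUNDARY-THREADED states (cost (4b) of V8-b′)

Crux chain w42 (`SigmaMaxModifications`, stmt-ResolutionOfSingularities-18506; conjunct `SigmaMaxModificationsCorridor3`,
stmt-ResolutionOfSingularities-19249), res-L1-w42-plan-1 RULING v3.14-12 (BR-2) «Ω⁺E := 040 cost (4b) after 1c lands». Typer res-type-040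
(gen 18). Over res-L1-type-o1's boundary STATE layer `…Corridor3SigmaBoundaryDefs` (p523041: `Boundary`, `MarkedStageE`, `StrategyE`
(field `step … E C P'`), `Strategy.withBoundary`, `StrategyE.IsFunctional`, `CanonicalNearStepσE`), res-D-pv-047's `…Corridor3SigmaBoundaryRuns`
(p523856: `StageOracleE.namesE … L E S φ t`, `StageOracle.withBoundary`, `IsCanonicalStepΩE`, `OracleFunctionalΩE`, `StrategyE.ofStageOracleE`)
and res-type-040's Ω⁺ `…Corridor3SigmaCyclePlusDefs` (p523517: `IsReplayStepPlus` — boundary-independent, REUSED verbatim —,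
`IsCanonicalStepΩplus`, `OracleAdmissibleΩplus`). The scheme-side home of a FUNCTIONAL corner oracle `ω_ρ` (o1's finding, RULING (CL):
σ_ρ reads the E-frame; without `E` in the state an «∃ compatible boundary» oracle is not functional): Ω⁺E = Ω⁺ with the stage oracle reading
the boundary `E`. Every `theorem` is PROVED (`Iff.rfl` transports to the boundary-blind Ω⁺; uniqueness ports; Ω⁺E = ΩE on pending-invariant
states). OURS (cell res-hironaka, slot W4.2); NOT statements of H. Hironaka's manuscript [Hironaka2017] nor of [CossartJannsenSaito2020];
AI-drafted, weaker than expert review. Helper file `--supports stmt-ResolutionOfSingularities-19249` (counted 0).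

Contents (namespace `…Theorems.SigmaMaxModificationsCorridor3.Sigma`): `IsCanonicalStepΩplusE ω hW N ν L E P C P'`,
`isCanonicalStepΩplusE_withBoundary_iff`, `OracleAdmissibleΩplusE` (+ `oracleAdmissibleΩplusE_withBoundary`), `IsCanonicalStepΩplusE.hsStratum_nonempty`
/ `.centre_unique` / `.pending_unique` (functional ω, res-D-pv-047's `OracleFunctionalΩE`), `isCanonicalStepΩplusE_iff_of_pending` (Ω⁺E = ΩE on
CJS pending-invariant states), `StrategyE.ofStageOraclePlusE` (+ `_step_iff` `Iff.rfl`, `StrategyE.isFunctional_ofStageOraclePlusE`,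
`StrategyE.ofStageOraclePlusE_withBoundary_step_iff`).
-/

noncomputable section

set_option linter.dupNamespace false

open CategoryTheory AlgebraicGeometry TopologicalSpace
open Summit.ResolutionOfSingularities.ResolutionOfSingularities.Theorems.CampaignW42
open Literature.AlgebraicGeometry.Resolution Literature.RingTheory.HilbertSamuel

namespace Summit.ResolutionOfSingularities.ResolutionOfSingularities.Theorems.SigmaMaxModificationsCorridor3.Sigma

universe u

variable {W : Scheme.{u}}

/-- [OURS · L1 W4.2] **ONE Ω⁺-STEP OVER A BOUNDARY-THREADED STATE**: `IsCanonicalStepΩplus` with the stage oracle reading the boundary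
`E` (`ω.namesE W hW N ν L E S φ t`); least non-empty label, reduced structure on its part, the oracle's sequence on the embedded part,
`IsReplayStepPlus` replay, cycle END on the strict transform of the part. The boundary itself is updated by the step relation of part 1c
(`Boundary.next`), not chosen here. NOT a statement of the manuscript. [cite: CossartJannsenSaito2020, Rem. 6.29 (1)] -/
def IsCanonicalStepΩplusE (ω : StageOracleE.{u}) (hW : IsLocallyNoetherian W) (N : ℕ) (ν : ℕ → ℕ) (L : Labelling W)
    (E : Boundary W) : Option (Pending W) → (C : W.IdealSheafData) → Option (Pending (blowup C)) → Prop
  | none, C, P' =>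
      ∃ j, IsLeast {i | (L.part (Scheme.hsStratum W N ν) i).Nonempty} j ∧
        ∃ h : IsClosed (L.part (Scheme.hsStratum W N ν) j),
          ∃ t : CentreSeq
              (Scheme.IdealSheafData.vanishingIdeal ⟨L.part (Scheme.hsStratum W N ν) j, h⟩).subscheme,
            ω.namesE W hW N ν L E _
                (Scheme.IdealSheafData.vanishingIdeal ⟨L.part (Scheme.hsStratum W N ν) j, h⟩).subschemeι t ∧
              IsReplayStepPlus L (Scheme.hsStratum W N ν) j
                (Scheme.IdealSheafData.vanishingIdeal ⟨L.part (Scheme.hsStratum W N ν) j, h⟩).subschemeι t C P'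
  | some P, C, P' =>
      (Scheme.hsStratum W N ν).Nonempty ∧ IsReplayStepPlus L (Scheme.hsStratum W N ν) P.lbl P.hom P.rest C P'

/-- **A BOUNDARY-BLIND stage oracle (`StageOracle.withBoundary`) gives the boundary-blind Ω⁺ step** (each case `Iff.rfl`). [folklore] -/
theorem isCanonicalStepΩplusE_withBoundary_iff (ω : StageOracle.{u}) (hW : IsLocallyNoetherian W) (N : ℕ) (ν : ℕ → ℕ)
    (L : Labelling W) (E : Boundary W) (P : Option (Pending W)) (C : W.IdealSheafData) (P' : Option (Pending (blowup C))) :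
    IsCanonicalStepΩplusE ω.withBoundary hW N ν L E P C P' ↔ IsCanonicalStepΩplus ω hW N ν L P C P' := by
  cases P with
  | none => exact Iff.rfl
  | some P => exact Iff.rfl

/-- [OURS · L1 W4.2] **ADMISSIBLE boundary-reading stage oracle, Ω⁺ form**: regular centres, regular last stage (as `OracleAdmissibleΩplus`).
[cite: CossartJannsenSaito2020, Thm. 3.3, Rem. 6.29 (1)] -/
def OracleAdmissibleΩplusE (ω : StageOracleE.{u}) : Prop :=
  ∀ (W : Scheme.{u}) (hW : IsLocallyNoetherian W) (N : ℕ) (ν : ℕ → ℕ) (L : Labelling W) (E : Boundary W) (S : Scheme.{u})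
    (φ : S ⟶ W) (t : CentreSeq S), ω.namesE W hW N ν L E S φ t →
    t.AllRegular ∧ Literature.AlgebraicGeometry.Resolution.Scheme.IsRegular t.top

/-- Boundary-blind oracles: Ω⁺-admissibility transfers. [folklore] -/
theorem oracleAdmissibleΩplusE_withBoundary {ω : StageOracle.{u}} (h : OracleAdmissibleΩplus ω) : OracleAdmissibleΩplusE ω.withBoundary :=
  fun W hW N ν L _ S φ t ht => h W hW N ν L S φ t ht

variable {ω : StageOracleE.{u}} {hW : IsLocallyNoetherian W} {N : ℕ} {ν : ℕ → ℕ}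

/-- No Ω⁺E-step leaves a stage whose `ν`-stratum is empty. [cite: CossartJannsenSaito2020, Rem. 6.29 (1)] -/
theorem IsCanonicalStepΩplusE.hsStratum_nonempty {L : Labelling W} {E : Boundary W} {P : Option (Pending W)}
    {C : W.IdealSheafData} {P' : Option (Pending (blowup C))} (h : IsCanonicalStepΩplusE ω hW N ν L E P C P') :
    (Scheme.hsStratum W N ν).Nonempty := by
  cases P with
  | none =>
    obtain ⟨j, hj, -⟩ := h
    exact (L.exists_part_nonempty_iff _).mp ⟨j, hj.1⟩
  | some P => exact h.1

/-- For a functional boundary-reading oracle the Ω⁺E-step has a well-determined centre. [cite: CossartJannsenSaito2020, Rem. 6.29 (1)] -/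
theorem IsCanonicalStepΩplusE.centre_unique (hω : OracleFunctionalΩE ω) {L : Labelling W} {E : Boundary W}
    {P : Option (Pending W)} {C₁ C₂ : W.IdealSheafData} {P₁ : Option (Pending (blowup C₁))} {P₂ : Option (Pending (blowup C₂))}
    (h₁ : IsCanonicalStepΩplusE ω hW N ν L E P C₁ P₁) (h₂ : IsCanonicalStepΩplusE ω hW N ν L E P C₂ P₂) : C₁ = C₂ := by
  cases P with
  | none =>
    obtain ⟨j₁, hj₁, hcl₁, t₁, hR₁, hs₁⟩ := h₁
    obtain ⟨j₂, hj₂, hcl₂, t₂, hR₂, hs₂⟩ := h₂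
    obtain rfl : j₁ = j₂ := hj₁.unique hj₂
    obtain rfl : t₁ = t₂ := hω _ _ _ _ _ _ _ _ _ _ hR₁ hR₂
    exact hs₁.centre_unique hs₂
  | some P => exact IsReplayStepPlus.centre_unique h₁.2 h₂.2

/-- … and a well-determined next cycle state. [cite: CossartJannsenSaito2020, Rem. 6.29 (1)] -/
theorem IsCanonicalStepΩplusE.pending_unique (hω : OracleFunctionalΩE ω) {L : Labelling W} {E : Boundary W}
    {P : Option (Pending W)} {C : W.IdealSheafData} {P₁ P₂ : Option (Pending (blowup C))}
    (h₁ : IsCanonicalStepΩplusE ω hW N ν L E P C P₁) (h₂ : IsCanonicalStepΩplusE ω hW N ν L E P C P₂) : P₁ = P₂ := by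
  cases P with
  | none =>
    obtain ⟨j₁, hj₁, hcl₁, t₁, hR₁, hs₁⟩ := h₁
    obtain ⟨j₂, hj₂, hcl₂, t₂, hR₂, hs₂⟩ := h₂
    obtain rfl : j₁ = j₂ := hj₁.unique hj₂
    obtain rfl : t₁ = t₂ := hω _ _ _ _ _ _ _ _ _ _ hR₁ hR₂
    exact hs₁.pending_unique hs₂
  | some P =>
    haveI := P.isClosedImmersion
    exact IsReplayStepPlus.pending_unique h₁.2 h₂.2

/-- **Ω⁺E = ΩE on states under the CJS pending invariant** (hence = the CJS step for blind lifted oracles), any boundary `E`.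
[cite: CossartJannsenSaito2020, Rem. 6.29 (1)] -/
theorem isCanonicalStepΩplusE_iff_of_pending {L : Labelling W} {E : Boundary W} {P : Option (Pending W)}
    (hpend : ∀ Q, P = some Q → Set.range Q.hom.base = L.part (Scheme.hsStratum W N ν) Q.lbl)
    (C : W.IdealSheafData) (P' : Option (Pending (blowup C))) :
    IsCanonicalStepΩplusE ω hW N ν L E P C P' ↔ IsCanonicalStepΩE ω hW N ν L E P C P' := by
  cases P with
  | none =>
    refine exists_congr fun j => and_congr Iff.rfl (exists_congr fun hcl => exists_congr fun t => and_congr Iff.rfl ?_)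
    have hrange : Set.range (Scheme.IdealSheafData.vanishingIdeal
        ⟨L.part (Scheme.hsStratum W N ν) j, hcl⟩).subschemeι.base = L.part (Scheme.hsStratum W N ν) j := by
      rw [Scheme.IdealSheafData.range_subschemeι, Scheme.IdealSheafData.coe_support_vanishingIdeal]
      rfl
    cases t with
    | nil _ => exact isReplayStepPlus_nil_iff_of_range_eq L _ j _ hrange C P'
    | cons D t => exact Iff.rfl
  | some Q =>
    refine and_congr Iff.rfl ?_
    have hrange := hpend Q rfl
    revert hrange
    cases Q.rest with
    | nil _ => exact fun hrange => isReplayStepPlus_nil_iff_of_range_eq L _ Q.lbl Q.hom hrange C P'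
    | cons D t => exact fun _ => Iff.rfl

/-- [OURS · L1 W4.2] **THE Ω⁺E STRATEGY OF A BOUNDARY-READING STAGE ORACLE** (a `StrategyE` of part 1c). [cite: CossartJannsenSaito2020, Rem. 6.29 (1)] -/
def StrategyE.ofStageOraclePlusE (ω : StageOracleE.{u}) : StrategyE.{u} :=
  ⟨fun _ hW N ν L P E C P' => IsCanonicalStepΩplusE ω hW N ν L E P C P'⟩

/-- Unfolding (`Iff.rfl`). [folklore] -/
theorem StrategyE.ofStageOraclePlusE_step_iff (ω : StageOracleE.{u}) (W : Scheme.{u}) (hW : IsLocallyNoetherian W) (N : ℕ)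
    (ν : ℕ → ℕ) (L : Labelling W) (P : Option (Pending W)) (E : Boundary W) (C : W.IdealSheafData)
    (P' : Option (Pending (blowup C))) :
    (StrategyE.ofStageOraclePlusE ω).step W hW N ν L P E C P' ↔ IsCanonicalStepΩplusE ω hW N ν L E P C P' :=
  Iff.rfl

/-- **The blind embeddings commute with Ω⁺**: `(Strategy.ofStageOraclePlus ω).blind = StrategyE.ofStageOraclePlusE ω.withBoundary` (`rfl` up to
the case split of the `Iff.rfl` above). [folklore] -/
theorem StrategyE.ofStageOraclePlusE_withBoundary_step_iff (ω : StageOracle.{u}) (W : Scheme.{u}) (hW : IsLocallyNoetherian W) (N : ℕ)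
    (ν : ℕ → ℕ) (L : Labelling W) (P : Option (Pending W)) (E : Boundary W) (C : W.IdealSheafData)
    (P' : Option (Pending (blowup C))) :
    (StrategyE.ofStageOraclePlusE ω.withBoundary).step W hW N ν L P E C P' ↔
      (Strategy.ofStageOraclePlus ω).withBoundary.step W hW N ν L P E C P' := by
  rw [StrategyE.ofStageOraclePlusE_step_iff, isCanonicalStepΩplusE_withBoundary_iff]
  exact Iff.rfl

end Summit.ResolutionOfSingularities.ResolutionOfSingularities.Theorems.SigmaMaxModificationsCorridor3.Sigma

end
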